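import Summits.QuantumFields.YangMills.Theorems.BalabanUVNodesN12FlatLinAvgOntoPins
import Summits.QuantumFields.YangMills.Theorems.BalabanUVNodesK0Stub1RecordAveragingRightInverse
import HarnessLib

/-!
# BalabanUVNodes ∕ N12 — (J-b) module H2b: THE FLAT RIGHT INVERSE OF NODE 00's TRUE LINEARISED MULTI-SCALE (0.4)-AVERAGING `qLin j 1` ON [III] (2.2)∕(2.10)'s OWN INDEX
# SET `ConstrSet (genSet Ω k) k` — r12's READING (b), crossing bonds included — and on the record's `𝐁_k(Z) = Bj M₁ Z k`: UST's P2→P3 bridge `Q^{(j)} = L^j·Q_j − dΛ_j` in the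
# EXISTENCE edition (pins at the inner end-points, deep ones included; κ-correction at the outer ones), then `𝔰𝔲(N)`-valued and linear

Cell `pub-ymgap` (HUMAN RULINGS D-0062 ∕ D-0149), width seat `pub-ymgap-dag-n10-w1` g3; modules H1a∕H1b∕H2a = `…N12FlatStraightOntoRows` (p615796) ∕ `…N12FlatStraightOntoGenSet`
(p616977) ∕ `…N12FlatLinAvgOntoPins`.  Key K1⁷ `stmt-QuantumFields-20542`, `--kind proof --supports … --as helper`; count-neutral; THEOREMS ONLY (0 `def`, 0 `sorry`, 0 `instance`,
0 `notation`).  THIS IS WAY (ii) of the seat's located note (INBOX l.30547): the flat input `h₁` that module F (`…N12GuardedLinAvgRightInverse` §3) DISPLAYS — a real-linear right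
inverse of the linearised multi-scale (0.4)-constraint at `U₀ = 1` on the enumerated constrained bonds — CONSTRUCTED for the chart of record's own determining set `Bj M₁ Z k` with its
reading-(b) index set (n07-w2's `msChart`∕`ConstrSet` currency kept AS IS); module H3 composes it with F into `hsurj` at every guarded near-flat background.

THE CONSTRUCTION (UST `ChartHInvBridge`'s, minus tents and letters, plus the deep pins).  `Q^{(j)}` a `linAvg`-family (`exists_linFamily`; `= qLin j 1` on `𝔰𝔲(N)`-fields by n07-w1's
`qLin_one_eq_family`), `Λ_j` the hierarchical comb functional (`exists_combFamily`): `Q^{(j)}Y = L^j·Q_jY − dΛ_j(Y)` (`linFamily_eq_sub_comb`), `Q^{(j)}(dφ) = d(φ ∘ embIter j)`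
(`linFamily_grad`).  Data `X` on the rows; corrected data `X̃(j,c) = L^{−j}(X(j,c) + κ_j(c₊) − κ_j(c₋))`, `κ_j(u) = λ̄(X_{j−1})(u)` (comb mean of the level-`(j−1)` data over `B(u)`) at
an OUTER end-point `u` (centre off `Ω_j`), `0` otherwise; `Y₀ = H₀(X̃)` with H1b's linear straight right inverse; `φ(x) = Λ_j(Y₀)(w)` if `x = embIter j w` for an INNER end-point
`(j, w)` of a row (well defined: H2a's pin uniqueness), `0` otherwise; `Y = Y₀ + dφ`.  At a row `c` of level `j`: `Q^{(j)}Y(c) = X(j,c) + E(c₊) − E(c₋)`, `E(w) = κ_j(w) − Λ_j(Y₀)(w)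
+ φ(embIter j w)`, and `E = 0` at every end-point: at an inner one by the pin; at an outer one `u` (`j = i + 1`) because `φ` is pinned at `emb u` one level down (its centre IS
`embIter (i+1) u`; `emb u ∈ Γ_i` by the collar), `Λ_{i+1}(Y₀)(u) = L^i·λ̄(Q_iY₀)(u) + Λ_i(Y₀)(emb u)`, and `λ̄(Q_iY₀)(u)` reads `Q_iY₀` only on the `i`-bonds INSIDE `B(u)`
(`combMean_congr_stairs`, `blockOf_of_mem_walk_stairWord`), which are rows with inner end-points (collar + measurability), where `L^i·Q_iY₀ = X` — i.e. exactly `κ_{i+1}(u)`.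

CONTENTS.  §1 ★★★ `exists_linFamily_eq_on_genSet` (`∀ X, ∃ Y, ∀ idx, Q idx.1 Y idx.2.1 = X idx`; hypotheses `k ≤ m + K`, nesting, block-measurability, and the collar «every `i`-sub-block
of an `(i+1)`-block adjacent to `Ω_{i+1}^{(i+1)}` has its centre in `Ω_i`» DISPLAYED).  §2 ★★ `exists_linear_rightInverse_linFamily_genSet` (surjectivity ⇒ a LINEAR right inverse),
★★★ `exists_rightInverse_qLin_one_genSet` (`∃ H : (ConstrSet (genSet Ω k) k → 𝔰𝔲(N)) →ₗ[ℝ] (PBond P 0 → 𝔰𝔲(N)), ∀ X idx, qLin idx.1 1 (H X) idx.2.1 = ↑(X idx)`; the matrix right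
inverse retracted by `suProj`, which commutes with `Q^{(j)}` — k0-s1-w1's `linFamily_realLinear`), ★★★ `exists_rightInverse_qLin_one_Bj` — UNCONDITIONAL at `Bj M₁ Z k` under
`2 ≤ M₁`, `k ≤ m + K`, `L^k·M₁ ∣ sitesPerDir 0` (collar from H2a's `embIter_mem_maxDomT_of_adjacent`).

HONEST FRAMING.  Lattice combinatorics + finite-dimensional linear algebra at the FLAT configuration on the tree's own averaging; existence and linearity only — NO (46)-type letter
(`|HB| ≤ O(1)|B|` uniform in the volume) is claimed for reading (b); the ME #35 question (reading (b) vs [B6] (2.3)) is NOT adjudicated — the file shows the (b)-typed chart of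
record is submersive at the flat background; nothing of Bałaban's estimates asserted; N12 ∕ N10 ∕ N07 NOT discharged; K1⁷ NOT closed; count-neutral (typed 28∕28 · discharged 5∕27
unmoved); one finite 𝕋⁴ programme at fixed ε — R4 closes the conditional rung `BalabanLadder.UV` only; the YM mass gap (Clay) is NOT proved by any of this; nothing continuum ∕ ℝ⁴ ∕ OS.
-/

noncomputable section

open scoped BigOperators

namespace Summit.QuantumFields.YangMills.BalabanUVNodes.N12FlatLinAvgOntoGenSet

open Literature.MathematicalPhysics.QuantumFieldTheory.Balaban1983to89
open LatticeFieldCalculus B5Eq118OneStroke B15DeterminingSets BlockAveragingEMLLinearised T4Continuum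
open B14.Eq22Determines (IsBlockUnion)
open B14.Eq213DetSet (Bj maxDomT maxDomT_succ_subset isBlockUnion_maxDomT)
open B14.Eq213MaximalDomains (side)
open Node00 (ConstrSet SU suProj suProj_coe qLin qLin_one_eq_family)
open T4AdjointCovarianceUnitary (lieSU)
open B10StarCount (shift_unshift unshift_shift)
open Literature.MathematicalPhysics.QuantumFieldTheory.BalabanImbrieJaffe1984to88.BIJ88RT51Background (iterBlockOf_embIter)
open Summit.QuantumFields.YangMills.Theorems.ChartHInv (exists_linFamily exists_combFamily linFamily_add linFamily_const_smul linFamily_grad linFamily_eq_sub_comb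
  combMean_congr_stairs combMean_real_smul blockOf_of_mem_walk_stairWord)
open Summit.QuantumFields.YangMills.Theorems.K0Stub1RecordAveragingRightInverse (linFamily_realLinear)
open N12FlatStraightOntoGenSet (embIter_mem_of_mem_genSet embIter_not_mem_succ_of_mem_genSet exists_linear_rightInverse_bondAvgIter_genSet_vec)
open N12FlatLinAvgOntoPins (embIter_mem_iff_of_isBlockUnion_succ false_of_embIter_eq_of_endpoint embIter_mem_maxDomT_of_adjacent)

variable {P : Params} {N : ℕ}

/-! ## §1  The bridge: from the straight right inverse (H1b) to the true linearised constraint on the reading-(b) rows -/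

section Bridge

variable (Q : (i : ℕ) → (PBond P 0 → Matrix (Fin N) (Fin N) ℂ) → PBond P i → Matrix (Fin N) (Fin N) ℂ)
  (hQ0 : ∀ Y, Q 0 Y = Y) (hQs : ∀ (i : ℕ) (Y : PBond P 0 → Matrix (Fin N) (Fin N) ℂ) (c : PBond P (i + 1)), Q (i + 1) Y c = linAvg (Q i Y) c)
variable (Ω : ℕ → Set (Site P 0)) {k : ℕ}

include hQ0 hQs in
/-- ★★★ **THE TRUE LINEARISED MULTI-SCALE CONSTRAINT IS ONTO THE READING-(b) DATA.**  Nested `Ω₁ ⊇ ⋯ ⊇ Ω_k` (`k ≤ m + K`), `Ω_i` a union of `i`-blocks, and the COLLAR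
«every `i`-sub-block of an `(i+1)`-block adjacent to `Ω_{i+1}^{(i+1)}` has its centre in `Ω_i`» (`1 ≤ i`, `i + 1 ≤ k`; at the record: module H2a's
`embIter_mem_maxDomT_of_adjacent`).  Then for every matrix datum `X` on `ConstrSet (genSet Ω k) k` there is a fine field `Y` with `Q^{(j)}Y(c) = X(j,c)` at every `j`-bond `c`
MEETING `Γ_j`, `Q^{(j)}` any `linAvg`-family (`Q^{(0)} = id`, `Q^{(j+1)} = linAvg ∘ Q^{(j)}`; = NODE 00's `qLin j 1` on `𝔰𝔲(N)`-fields, `qLin_one_eq_family`).  CONSTRUCTION (UST's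
P2→P3 bridge, existence edition): corrected data `X̃(j,c) = L^{−j}(X(j,c) + κ_j(c₊) − κ_j(c₋))` with `κ_j = ` the comb mean of the level-`(j−1)` data at OUTER end-points (centre off
`Ω_j`) and `0` elsewhere; `Y₀ = H(X̃)` the straight solution of H1b; `φ(x) = Λ_j(Y₀)(w)` if `x` is the centre of an INNER end-point `(j, w)` of a row (well defined by H2a's pin
uniqueness), `0` elsewhere; `Y = Y₀ + dφ`.  Then `Q^{(j)}Y = L^jQ_jY₀ − dΛ_j(Y₀) + d(φ ∘ embIter j)` and at each end-point the three corrections cancel: at an inner one by the pin,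
at an outer one `u` because `φ` is pinned one level down at `emb u` and `Λ_j(Y₀)(u) − Λ_{j−1}(Y₀)(emb u) = L^{j−1}·λ̄(Q_{j−1}Y₀)(u)` reads only the `(j−1)`-bonds inside `B(u)`, which are
rows (collar) carrying `L^{1−j}X` (straight solution, no correction at their inner end-points) — exactly `κ_j(u)`.
[cite: Balaban1985Variational, (44)-(47) p.285; Balaban1985Averaging, (62) p.28, (124)-(125) p.36; Balaban1988Convergent, (2.2) p.255, (2.10)-(2.12) p.256] -/
theorem exists_linFamily_eq_on_genSet (hkK : k ≤ P.m + P.K) (hnest : ∀ i, 1 ≤ i → i < k → Ω (i + 1) ⊆ Ω i)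
    (hmeas : ∀ i, 1 ≤ i → i ≤ k → IsBlockUnion i (Ω i))
    (hcollar : ∀ i, 1 ≤ i → i + 1 ≤ k → ∀ (w : Site P (i + 1)) (μ : Fin P.d),
      (embIter (i + 1) (w.shift μ) ∈ Ω (i + 1) ∨ embIter (i + 1) (w.unshift μ) ∈ Ω (i + 1)) → ∀ v : Site P i, blockOf v = w → embIter i v ∈ Ω i)
    (X : ConstrSet (genSet Ω k) k → Matrix (Fin N) (Fin N) ℂ) :
    ∃ Y : PBond P 0 → Matrix (Fin N) (Fin N) ℂ, ∀ idx : ConstrSet (genSet Ω k) k, Q (idx.1 : ℕ) Y idx.2.1 = X idx := by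
  classical
  obtain ⟨Λ, hΛ0, hΛs⟩ := exists_combFamily (P := P) (n := Fin N)
  obtain ⟨H₀, hH₀⟩ := exists_linear_rightInverse_bondAvgIter_genSet_vec Ω hkK hnest hmeas (V := Matrix (Fin N) (Fin N) ℂ)
  have hLr : (P.L : ℝ) ≠ 0 := Nat.cast_ne_zero.mpr P.L_pos.ne'
  -- rows, inside end-points, the data as level fields, the end-point correction, the corrected data, the straight solution
  let Row : (j : ℕ) → PBond P j → Prop := fun j c => c ∈ bondsOf (genSet Ω k j)
  let In : (j : ℕ) → Site P j → Prop := fun j w => j = 0 ∨ embIter j w ∈ Ω j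
  let Xf : (i : ℕ) → PBond P i → Matrix (Fin N) (Fin N) ℂ := fun i b =>
    if h : i ≤ k ∧ Row i b then X ⟨⟨i, Nat.lt_succ_of_le h.1⟩, b, h.2⟩ else 0
  let corr : (j : ℕ) → Site P j → Matrix (Fin N) (Fin N) ℂ := fun j =>
    match j with
    | 0 => fun _ => 0
    | i + 1 => fun w => if embIter (i + 1) w ∈ Ω (i + 1) then 0 else combMean (Xf i) w
  let Xt : ConstrSet (genSet Ω k) k → Matrix (Fin N) (Fin N) ℂ := fun idx =>
    (((P.L : ℝ) ^ (idx.1 : ℕ))⁻¹) • (X idx + corr idx.1 idx.2.1.tgt - corr idx.1 idx.2.1.src)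
  let Y₀ : PBond P 0 → Matrix (Fin N) (Fin N) ℂ := H₀ Xt
  -- pins and the gauge function
  let IsPin : (j : ℕ) → Site P j → Prop := fun j w => j ≤ k ∧ In j w ∧ ∃ μ : Fin P.d, Row j ⟨w, μ⟩ ∨ Row j ⟨w.unshift μ, μ⟩
  let φ : Site P 0 → Matrix (Fin N) (Fin N) ℂ := fun x =>
    if h : ∃ p : (Σ j : ℕ, Site P j), IsPin p.1 p.2 ∧ embIter p.1 p.2 = x then Λ h.choose.1 Y₀ h.choose.2 else 0
  -- basic facts
  have hIn_of_row : ∀ (j : ℕ) (c : PBond P j), Row j c → In j c.src ∨ In j c.tgt := by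
    intro j c hc
    rcases Nat.eq_zero_or_pos j with rfl | hj
    · exact Or.inl (Or.inl rfl)
    · have hjk : j ≤ k := by
        by_contra h
        have : genSet Ω k j = ∅ := by rw [genSet, gammaRegion_of_gt Ω (not_le.mp h)]; rfl
        rcases hc with h' | h' <;> rw [this] at h' <;> exact h'
      rcases hc with h' | h'
      · exact Or.inl (Or.inr (embIter_mem_of_mem_genSet Ω hj hjk h'))
      · exact Or.inr (Or.inr (embIter_mem_of_mem_genSet Ω hj hjk h'))
  have hrow_le : ∀ (j : ℕ) (c : PBond P j), Row j c → j ≤ k := by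
    intro j c hc
    by_contra h
    have : genSet Ω k j = ∅ := by rw [genSet, gammaRegion_of_gt Ω (not_le.mp h)]; rfl
    rcases hc with h' | h' <;> rw [this] at h' <;> exact h'
  -- pin uniqueness (H2a) and the value of `φ` at a pinned centre
  have huniq : ∀ (j j' : ℕ) (w : Site P j) (w' : Site P j'), IsPin j w → IsPin j' w' → embIter j w = embIter j' w' →
      (⟨j, w⟩ : Σ j : ℕ, Site P j) = ⟨j', w'⟩ := by
    intro j j' w w' hp hp' heq
    rcases lt_trichotomy j j' with hlt | rfl | hgt
    · have hw' : embIter j' w' ∈ Ω j' := by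
        rcases hp'.2.1 with h | h
        · omega
        · exact h
      exact (false_of_embIter_eq_of_endpoint Ω hkK hnest hmeas hlt hp'.1 heq hw' hp.2.2).elim
    · have : w = w' := by
        have h1 := iterBlockOf_embIter j (hp.1.trans hkK) w
        rw [heq, iterBlockOf_embIter j (hp.1.trans hkK) w'] at h1
        exact h1.symm
      rw [this]
    · have hw : embIter j w ∈ Ω j := by
        rcases hp.2.1 with h | h
        · omega
        · exact h
      exact (false_of_embIter_eq_of_endpoint Ω hkK hnest hmeas hgt hp.1 heq.symm hw hp'.2.2).elim
  have hφ : ∀ (j : ℕ) (w : Site P j), IsPin j w → φ (embIter j w) = Λ j Y₀ w := by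
    intro j w hp
    have hex : ∃ p : (Σ j : ℕ, Site P j), IsPin p.1 p.2 ∧ embIter p.1 p.2 = embIter j w := ⟨⟨j, w⟩, hp, rfl⟩
    show (if h : ∃ p : (Σ j : ℕ, Site P j), IsPin p.1 p.2 ∧ embIter p.1 p.2 = embIter j w then Λ h.choose.1 Y₀ h.choose.2 else 0) = Λ j Y₀ w
    rw [dif_pos hex]
    have hc := hex.choose_spec
    have hpw : (⟨hex.choose.1, hex.choose.2⟩ : Σ j : ℕ, Site P j) = ⟨j, w⟩ := huniq _ _ _ _ hc.1 hp hc.2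
    generalize hq : hex.choose = q at hpw ⊢
    obtain ⟨j₁, w₁⟩ := q
    simp only [Sigma.mk.inj_iff] at hpw
    obtain ⟨rfl, hww⟩ := hpw
    rw [eq_of_heq hww]
  -- the correction vanishes at inside sites
  have hcorr_in : ∀ (j : ℕ) (w : Site P j), In j w → corr j w = 0 := by
    intro j w hw
    cases j with
    | zero => rfl
    | succ i =>
      rcases hw with h | h
      · omega
      · show (if embIter (i + 1) w ∈ Ω (i + 1) then (0 : Matrix (Fin N) (Fin N) ℂ) else combMean (Xf i) w) = 0
        rw [if_pos h]
  -- ★ the three corrections cancel at every end-point of every row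
  have hE : ∀ (j : ℕ) (c : PBond P j), Row j c → ∀ w : Site P j, (w = c.src ∨ w = c.tgt) → corr j w - Λ j Y₀ w + φ (embIter j w) = 0 := by
    intro j c hc w hw
    have hjk : j ≤ k := hrow_le j c hc
    have hends : ∃ μ : Fin P.d, Row j ⟨w, μ⟩ ∨ Row j ⟨w.unshift μ, μ⟩ := by
      refine ⟨c.dir, ?_⟩
      rcases hw with rfl | rfl
      · exact Or.inl hc
      · right
        have : (⟨c.tgt.unshift c.dir, c.dir⟩ : PBond P j) = c := by
          cases c with
          | mk s μ => show (⟨(s.shift μ).unshift μ, μ⟩ : PBond P j) = ⟨s, μ⟩; rw [unshift_shift]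
        rw [this]; exact hc
    by_cases hin : In j w
    · -- inner end-point: pinned
      rw [hcorr_in j w hin, hφ j w ⟨hjk, hin, hends⟩, zero_sub, neg_add_cancel]
    · -- outer end-point: `j = i + 1`, centre off `Ω_{i+1}`
      obtain ⟨i, rfl⟩ : ∃ i, j = i + 1 := ⟨j - 1, by rcases Nat.eq_zero_or_pos j with rfl | h; exact absurd (Or.inl rfl) hin; omega⟩
      have hout : embIter (i + 1) w ∉ Ω (i + 1) := fun h => hin (Or.inr h)
      have hi1K : i + 1 ≤ P.m + P.K := hjk.trans hkK
      -- the other end-point is in `Γ_{i+1}`: `w` is adjacent to `Ω_{i+1}`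
      have hadj : embIter (i + 1) (w.shift c.dir) ∈ Ω (i + 1) ∨ embIter (i + 1) (w.unshift c.dir) ∈ Ω (i + 1) := by
        have hmem : ∀ v : Site P (i + 1), v ∈ genSet Ω k (i + 1) → embIter (i + 1) v ∈ Ω (i + 1) :=
          fun v hv => embIter_mem_of_mem_genSet Ω (by omega) hjk hv
        rcases hw with rfl | rfl
        · rcases hc with h | h
          · exact absurd (hmem _ h) hout
          · exact Or.inl (hmem _ h)
        · rcases hc with h | h
          · right
            have : c.tgt.unshift c.dir = c.src := by show (c.src.shift c.dir).unshift c.dir = c.src; rw [unshift_shift]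
            rw [this]; exact hmem _ h
          · exact absurd (hmem _ h) hout
      -- every `i`-sub-block of `w` is inside at level `i` and lies in `Γ_i`
      have hsub : ∀ v : Site P i, blockOf v = w → In i v := by
        intro v hv
        rcases Nat.eq_zero_or_pos i with rfl | hi
        · exact Or.inl rfl
        · exact Or.inr (hcollar i hi hjk w c.dir hadj v hv)
      have hsubΓ : ∀ v : Site P i, blockOf v = w → v ∈ genSet Ω k i := by
        intro v hv
        have hnot : embIter i v ∉ Ω (i + 1) := by
          rw [embIter_mem_iff_of_isBlockUnion_succ (hmeas (i + 1) (by omega) hjk) hi1K, hv]; exact hout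
        rw [genSet, mem_pts]
        rcases Nat.eq_zero_or_pos i with rfl | hi
        · rw [gammaRegion_zero Ω (by omega)]; exact hnot
        · rw [gammaRegion_mid Ω hi (by omega)]
          refine ⟨?_, hnot⟩
          rcases hsub v hv with h | h
          · omega
          · exact h
      -- the pin one level down at `emb w`
      have hpin : IsPin i (emb w) := by
        refine ⟨by omega, hsub _ (Site.blockOf_emb hi1K w), ⟨⟨0, P.hd⟩, Or.inl (Or.inl (hsubΓ _ (Site.blockOf_emb hi1K w)))⟩⟩
      have hφw : φ (embIter (i + 1) w) = Λ i Y₀ (emb w) := hφ i (emb w) hpin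
      -- the defect is the comb mean of the data
      have hcorr : corr (i + 1) w = combMean (Xf i) w := by
        show (if embIter (i + 1) w ∈ Ω (i + 1) then (0 : Matrix (Fin N) (Fin N) ℂ) else combMean (Xf i) w) = _
        rw [if_neg hout]
      have hcomb : combMean (Xf i) w = (P.L ^ i : ℕ) • combMean (bondAvgIter i Y₀) w := by
        rw [← Nat.cast_smul_eq_nsmul ℝ, ← combMean_real_smul]
        refine combMean_congr_stairs w fun σ r s hs => ?_
        obtain ⟨hbs, hbt⟩ := blockOf_of_mem_walk_stairWord hi1K w σ r hs
        have hrow : Row i s.bond := Or.inl (hsubΓ _ hbs)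
        have hik : i ≤ k := by omega
        have hXf : Xf i s.bond = X ⟨⟨i, Nat.lt_succ_of_le hik⟩, s.bond, hrow⟩ := by
          show (if h : i ≤ k ∧ Row i s.bond then X ⟨⟨i, Nat.lt_succ_of_le h.1⟩, s.bond, h.2⟩ else 0) = _
          rw [dif_pos ⟨hik, hrow⟩]
        have hQ : bondAvgIter i Y₀ s.bond = Xt ⟨⟨i, Nat.lt_succ_of_le hik⟩, s.bond, hrow⟩ := hH₀ Xt ⟨⟨i, Nat.lt_succ_of_le hik⟩, s.bond, hrow⟩
        rw [hXf, hQ]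
        show _ = ((P.L ^ i : ℕ) : ℝ) • ((((P.L : ℝ) ^ i)⁻¹) • (X ⟨⟨i, _⟩, s.bond, hrow⟩ + corr i s.bond.tgt - corr i s.bond.src))
        rw [hcorr_in i _ (hsub _ hbt), hcorr_in i _ (hsub _ hbs), add_zero, sub_zero, smul_smul, Nat.cast_pow,
          mul_inv_cancel₀ (pow_ne_zero _ hLr), one_smul]
      rw [hcorr, hcomb, hΛs, show embIter (i + 1) w = embIter (i + 1) w from rfl, hφw]
      abel
  -- ★★★ the field and the identity on the rows
  refine ⟨fun b => Y₀ b + (φ b.tgt - φ b.src), fun idx => ?_⟩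
  obtain ⟨⟨j, hj⟩, c, hc⟩ := idx
  have hjk : j ≤ k := Nat.lt_succ_iff.mp hj
  have h1 := linFamily_add Q hQ0 hQs j Y₀ (fun b => φ b.tgt - φ b.src) c
  have h2 := linFamily_eq_sub_comb Q hQ0 hQs Λ hΛ0 hΛs Y₀ j c
  have h3 := linFamily_grad Q hQ0 hQs φ j c
  have h4 : bondAvgIter j Y₀ c = Xt ⟨⟨j, hj⟩, c, hc⟩ := hH₀ Xt ⟨⟨j, hj⟩, c, hc⟩
  have hs := hE j c hc c.src (Or.inl rfl)
  have ht := hE j c hc c.tgt (Or.inr rfl)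
  show Q j (fun b => Y₀ b + (φ b.tgt - φ b.src)) c = X ⟨⟨j, hj⟩, c, hc⟩
  rw [h1, h2, h3, h4]
  show (P.L ^ j : ℕ) • ((((P.L : ℝ) ^ j)⁻¹) • (X ⟨⟨j, hj⟩, c, hc⟩ + corr j c.tgt - corr j c.src)) - (Λ j Y₀ c.tgt - Λ j Y₀ c.src) +
      (φ (embIter j c.tgt) - φ (embIter j c.src)) = X ⟨⟨j, hj⟩, c, hc⟩
  rw [← Nat.cast_smul_eq_nsmul ℝ, smul_smul, Nat.cast_pow, mul_inv_cancel₀ (pow_ne_zero _ hLr), one_smul]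
  have key : X ⟨⟨j, hj⟩, c, hc⟩ + corr j c.tgt - corr j c.src - (Λ j Y₀ c.tgt - Λ j Y₀ c.src) + (φ (embIter j c.tgt) - φ (embIter j c.src)) =
      X ⟨⟨j, hj⟩, c, hc⟩ + (corr j c.tgt - Λ j Y₀ c.tgt + φ (embIter j c.tgt)) - (corr j c.src - Λ j Y₀ c.src + φ (embIter j c.src)) := by abel
  rw [key, hs, ht, sub_zero, add_zero]

end Bridge

/-! ## §2  A LINEAR right inverse; the `𝔰𝔲(N)`-valued edition for NODE 00's `qLin j 1`; the record's `𝐁_k(Z)` -/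

section Linear

variable (Q : (i : ℕ) → (PBond P 0 → Matrix (Fin N) (Fin N) ℂ) → PBond P i → Matrix (Fin N) (Fin N) ℂ)
  (hQ0 : ∀ Y, Q 0 Y = Y) (hQs : ∀ (i : ℕ) (Y : PBond P 0 → Matrix (Fin N) (Fin N) ℂ) (c : PBond P (i + 1)), Q (i + 1) Y c = linAvg (Q i Y) c)
variable (Ω : ℕ → Set (Site P 0)) {k : ℕ}

include hQ0 hQs in
/-- ★★ **A LINEAR RIGHT INVERSE** of `Y ↦ (Q^{(j)}Y(c))_{(j,c) ∈ ConstrSet (genSet Ω k) k}` on matrix data (surjectivity of §1 + `LinearMap.exists_rightInverse_of_surjective`; `Q^{(j)}` is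
real-linear by UST `linFamily_add` ∕ `linFamily_const_smul`). [cite: Balaban1985Variational, (45) p.285; Balaban1988Convergent, (2.10)-(2.12) p.256] -/
theorem exists_linear_rightInverse_linFamily_genSet (hkK : k ≤ P.m + P.K) (hnest : ∀ i, 1 ≤ i → i < k → Ω (i + 1) ⊆ Ω i)
    (hmeas : ∀ i, 1 ≤ i → i ≤ k → IsBlockUnion i (Ω i))
    (hcollar : ∀ i, 1 ≤ i → i + 1 ≤ k → ∀ (w : Site P (i + 1)) (μ : Fin P.d),
      (embIter (i + 1) (w.shift μ) ∈ Ω (i + 1) ∨ embIter (i + 1) (w.unshift μ) ∈ Ω (i + 1)) → ∀ v : Site P i, blockOf v = w → embIter i v ∈ Ω i) :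
    ∃ G : (ConstrSet (genSet Ω k) k → Matrix (Fin N) (Fin N) ℂ) →ₗ[ℝ] (PBond P 0 → Matrix (Fin N) (Fin N) ℂ),
      ∀ (X : ConstrSet (genSet Ω k) k → Matrix (Fin N) (Fin N) ℂ) (idx : ConstrSet (genSet Ω k) k), Q (idx.1 : ℕ) (G X) idx.2.1 = X idx := by
  let T : (PBond P 0 → Matrix (Fin N) (Fin N) ℂ) →ₗ[ℝ] (ConstrSet (genSet Ω k) k → Matrix (Fin N) (Fin N) ℂ) :=
    { toFun := fun Y idx => Q (idx.1 : ℕ) Y idx.2.1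
      map_add' := fun Y Y' => funext fun idx => linFamily_add Q hQ0 hQs _ Y Y' _
      map_smul' := fun r Y => funext fun idx => by
        have h := linFamily_const_smul Q hQ0 hQs (r : ℂ) (idx.1 : ℕ) Y idx.2.1
        simp only [Complex.coe_smul] at h
        exact h }
  have hT : LinearMap.range T = ⊤ := LinearMap.range_eq_top.mpr fun X => by
    obtain ⟨Y, hY⟩ := exists_linFamily_eq_on_genSet Q hQ0 hQs Ω hkK hnest hmeas hcollar X
    exact ⟨Y, funext hY⟩
  obtain ⟨G, hG⟩ := T.exists_rightInverse_of_surjective hT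
  exact ⟨G, fun X idx => by
    have := LinearMap.congr_fun hG X
    exact congrFun this idx⟩

variable [NeZero N]

/-- ★★★ **THE FLAT RIGHT INVERSE OF NODE 00's LINEARISED `k`-FOLD (0.4)-AVERAGING `qLin j 1` ON THE READING-(b) ROWS, `𝔰𝔲(N)`-VALUED AND LINEAR**: a real-linear
`H : (ConstrSet (genSet Ω k) k → 𝔰𝔲(N)) → (fine bonds → 𝔰𝔲(N))` with `qLin j 1 (H X) c = X(j,c)` at every `j`-bond `c` meeting `Γ_j` (n07-w1's `qLin_one_eq_family` + the matrix right
inverse followed by the real-linear retraction `suProj`, which commutes with every `linAvg`-family — k0-s1-w1's `linFamily_realLinear`). [cite: Balaban1985Variational, (44)-(47) p.285; Balaban1988Convergent, (2.10)-(2.12) p.256] -/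
theorem exists_rightInverse_qLin_one_genSet (hkK : k ≤ P.m + P.K) (hnest : ∀ i, 1 ≤ i → i < k → Ω (i + 1) ⊆ Ω i)
    (hmeas : ∀ i, 1 ≤ i → i ≤ k → IsBlockUnion i (Ω i))
    (hcollar : ∀ i, 1 ≤ i → i + 1 ≤ k → ∀ (w : Site P (i + 1)) (μ : Fin P.d),
      (embIter (i + 1) (w.shift μ) ∈ Ω (i + 1) ∨ embIter (i + 1) (w.unshift μ) ∈ Ω (i + 1)) → ∀ v : Site P i, blockOf v = w → embIter i v ∈ Ω i) :
    ∃ H : (ConstrSet (genSet Ω k) k → lieSU (Fin N)) →ₗ[ℝ] (PBond P 0 → lieSU (Fin N)),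
      ∀ (X : ConstrSet (genSet Ω k) k → lieSU (Fin N)) (idx : ConstrSet (genSet Ω k) k),
        qLin (idx.1 : ℕ) (1 : GaugeField P 0 (SU N)) (H X) idx.2.1 = (X idx : Matrix (Fin N) (Fin N) ℂ) := by
  obtain ⟨Q, hQ0, hQs⟩ := exists_linFamily (P := P) (n := Fin N)
  obtain ⟨G, hG⟩ := exists_linear_rightInverse_linFamily_genSet Q hQ0 hQs Ω hkK hnest hmeas hcollar
  -- coefficientwise: coerce the data, apply `G`, retract to `𝔰𝔲(N)`
  let ι : (ConstrSet (genSet Ω k) k → lieSU (Fin N)) →ₗ[ℝ] (ConstrSet (genSet Ω k) k → Matrix (Fin N) (Fin N) ℂ) :=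
    { toFun := fun X idx => (X idx : Matrix (Fin N) (Fin N) ℂ)
      map_add' := fun X X' => rfl
      map_smul' := fun r X => rfl }
  let ρ : (PBond P 0 → Matrix (Fin N) (Fin N) ℂ) →ₗ[ℝ] (PBond P 0 → lieSU (Fin N)) :=
    { toFun := fun Y b => suProj N (Y b)
      map_add' := fun Y Y' => funext fun b => map_add _ _ _
      map_smul' := fun r Y => funext fun b => by simp only [Pi.smul_apply, RingHom.id_apply, map_smul] }
  refine ⟨ρ ∘ₗ G ∘ₗ ι, fun X idx => ?_⟩
  have hπ := linFamily_realLinear Q hQ0 hQs ((lieSU (Fin N)).subtype.comp (suProj N).toLinearMap) (G (ι X)) (idx.1 : ℕ) idx.2.1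
  rw [qLin_one_eq_family Q hQ0 hQs]
  show Q (idx.1 : ℕ) (fun b => ((suProj N (G (ι X) b) : lieSU (Fin N)) : Matrix (Fin N) (Fin N) ℂ)) idx.2.1 = _
  have h1 : (fun b => ((suProj N (G (ι X) b) : lieSU (Fin N)) : Matrix (Fin N) (Fin N) ℂ)) =
      fun b => ((lieSU (Fin N)).subtype.comp (suProj N).toLinearMap) (G (ι X) b) := rfl
  rw [h1, hπ, hG]
  show ((suProj N ((X idx : lieSU (Fin N)) : Matrix (Fin N) (Fin N) ℂ) : lieSU (Fin N)) : Matrix (Fin N) (Fin N) ℂ) = _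
  rw [suProj_coe]

/-- ★★★ **AT THE RECORD's `𝐁_k(Z) = Bj M₁ Z k`** ([III] (2.13); `2 ≤ M₁`, `k ≤ m + K`, `L^k·M₁ ∣ sitesPerDir 0`): nesting and block-measurability from r11's `maxDomT`, the collar
from module H2a's `embIter_mem_maxDomT_of_adjacent` (`dist_maxDomT`).  This is module F's DISPLAYED flat input `h₁` at the chart of record (see module H3 for the `constrEnum`-indexed form
and the letter). [cite: Balaban1985Variational, (44)-(47) p.285; Balaban1988Convergent, (2.13) pp.256-257, (2.10)-(2.12) p.256] -/
theorem exists_rightInverse_qLin_one_Bj {M₁ : ℕ} (hM2 : 2 ≤ M₁) (hkK : k ≤ P.m + P.K) {Z : Set (Site P 0)} (hdiv : side P.L M₁ k ∣ P.sitesPerDir 0) :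
    ∃ H : (ConstrSet (Bj M₁ Z k : DetSet P) k → lieSU (Fin N)) →ₗ[ℝ] (PBond P 0 → lieSU (Fin N)),
      ∀ (X : ConstrSet (Bj M₁ Z k : DetSet P) k → lieSU (Fin N)) (idx : ConstrSet (Bj M₁ Z k : DetSet P) k),
        qLin (idx.1 : ℕ) (1 : GaugeField P 0 (SU N)) (H X) idx.2.1 = (X idx : Matrix (Fin N) (Fin N) ℂ) :=
  have hM : 1 ≤ M₁ := by omega
  exists_rightInverse_qLin_one_genSet (maxDomT M₁ Z) hkK (fun i _ _ => maxDomT_succ_subset hM Z i)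
    (fun _ hi1 hik => isBlockUnion_maxDomT hM hdiv hi1 hik (hik.trans hkK))
    (fun _ _ hik w μ hadj v hv => embIter_mem_maxDomT_of_adjacent hM2 hdiv hik (hik.trans hkK) w μ hadj v hv)

end Linear


end Summit.QuantumFields.YangMills.BalabanUVNodes.N12FlatLinAvgOntoGenSet

end
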